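import Summits.NavierStokesRegularity.NavierStokesRegularity.Theses.TerminalTrace
import Summits.NavierStokesRegularity.NavierStokesRegularity.Theses.TypeICertificateLadder
import Summits.NavierStokesRegularity.NavierStokesRegularity.Theorems.TerminalTraceTraceDensityCriterionTypeI
import Literature.Analysis.FluidPDE.NSCriticalClosureBesovKatoClass
import Literature.Analysis.FluidPDE.NSLerayHopfSereginMild
import HarnessLib

/-!
# Crux `TerminalTrace.NoTraceConcentration` (stmt-NavierStokesRegularity-18381) is AT LEAST AS STRONG AS TYPE-I EXCLUSION:
# `NoTraceConcentration → TypeICertificateLadder.NoTypeIBlowup`, BY NAME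

Seat nsreg-C26-p1 g6 (cell ns-regularity-ideate), `--supports stmt-NavierStokesRegularity-18381` (helper; a kernel record of
the STRENGTH of the crux — the route file's own warning «at least as hard as Type-I exclusion» made a theorem; nothing is
closed: both `NoTraceConcentration` and `NoTypeIBlowup` are open, hard-core-level statements).

* `TerminalTrace.noTypeIBlowup_of_noTraceConcentration : NoTraceConcentration → NoTypeIBlowup` — if the final value of
  every frame solution has no scaled-energy concentration at any point (crux B of route `TerminalTrace`), then a
  Type-I-in-time frame solution extends smoothly past `T` (the item `TypeICertificateLadder.NoTypeIBlowup`, shared by the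
  routes CoreLogGas, QuarterLogPincer, ExtremalTypeIConstant, AdaptedFrequency, PumpContinuation, …).  Proof: were there
  no smooth extension, a backward-singular vertex `(T, xs)` exists (the content of the proved support
  `BlowupHasSingularPoint`, stmt-NavierStokesRegularity-18382; used through the tree's
  `exists_singularPoint_of_classical_of_not_hasSmoothExtensionPast`, Lemarié-Rieusset 2016 Thm. 15.1 (C)); crux B gives FE(xs); the
  Type-I cell of crux A (`TerminalTrace.typeI_traceDensityCriterion`, this seat) makes `(T, xs)` backward bounded —
  contradiction (`TerminalTrace.typeI_not_tendsto_scaledEnergy_of_singular`).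
* `TerminalTrace.typeI_closes_of_noTraceConcentration` — the same in the route's own words: under crux B alone, the
  deciding chain of route `TerminalTrace` runs for Type-I-in-time solutions (crux A is then supplied by its Type-I cell).

WHAT THIS IS NOT: not NS regularity, not `NoTypeIBlowup`, not either crux — an implication between OPEN statements.
[folklore; EscauriazaSereginSverak2003 §3; AlbrittonBarker2019 §3; SereginSverak2002 §4] [cite: LemarieRieusset2016, Thm. 15.1 (C)]
-/

set_option linter.dupNamespace false

noncomputable section

open MeasureTheory Set Function Filter Topology Metric
open Literature.Analysis.FluidPDE

namespace Summit.NavierStokesRegularity.NavierStokesRegularity.Theorems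

/-- **Under crux B of route `TerminalTrace`, a Type-I-in-time frame solution extends smoothly past `T`.**  Frame
(`ν, T > 0`, classical on `[0, T)`, Leray–Hopf on `[0, T]`, rapidly decaying datum), `IsTypeIBlowup u T`, and
`NoTraceConcentration`: then `HasSmoothExtensionPast ν 0 u T`.  (Otherwise Lemarié-Rieusset's singular point (`exists_singularPoint_of_classical_of_not_hasSmoothExtensionPast`) yields a
backward-singular vertex, crux B the vanishing scaled energy of `u T` there, and the Type-I cell of crux A a bounded backward
cylinder — contradiction.) [folklore; EscauriazaSereginSverak2003 §3; AlbrittonBarker2019 §3] -/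
theorem TerminalTrace.typeI_closes_of_noTraceConcentration
    (hB : Summit.NavierStokesRegularity.NavierStokesRegularity.Theses.TerminalTrace.NoTraceConcentration)
    {ν T : ℝ} (hν : 0 < ν) (hT : 0 < T)
    {u : ℝ → EuclideanSpace ℝ (Fin 3) → EuclideanSpace ℝ (Fin 3)} {p : ℝ → EuclideanSpace ℝ (Fin 3) → ℝ}
    (hcl : IsClassicalNSSolutionOn (Ico 0 T) ν 0 u p) (hLH : IsLerayHopfOn T ν 0 (u 0) u)
    (hdec : HasRapidSpatialDecay (u 0)) (hI : IsTypeIBlowup u T) :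
    HasSmoothExtensionPast ν 0 u T := by
  by_contra hno
  -- a first-time blow-up carries a backward-singular vertex (Lemarié-Rieusset 2016 Thm. 15.1 (C), tree)
  obtain ⟨xs, hxs⟩ := exists_singularPoint_of_classical_of_not_hasSmoothExtensionPast hν hT hcl hLH hdec hno
  exact TerminalTrace.typeI_not_tendsto_scaledEnergy_of_singular hν hT hcl hLH hdec hI
    (fun r hr => eLpNorm_top_parabolicCylinder_eq_top_of_small hT hxs hr) (hB ν T hν hT u p hcl hLH hdec xs)

/-- **`NoTraceConcentration → NoTypeIBlowup`, BY NAME** (crux stmt-NavierStokesRegularity-18381 of route `TerminalTrace` is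
at least as strong as the shared item `TypeICertificateLadder.NoTypeIBlowup`, Type-I exclusion for Clay data): module
docstring. [folklore; EscauriazaSereginSverak2003 §3; AlbrittonBarker2019 §3] -/
theorem TerminalTrace.noTypeIBlowup_of_noTraceConcentration
    (hB : Summit.NavierStokesRegularity.NavierStokesRegularity.Theses.TerminalTrace.NoTraceConcentration) :
    Summit.NavierStokesRegularity.NavierStokesRegularity.Theses.TypeICertificateLadder.NoTypeIBlowup :=
  fun _ν _T hν hT _u _p hcl hLH hdec hI =>
    TerminalTrace.typeI_closes_of_noTraceConcentration hB hν hT hcl hLH hdec hI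

end Summit.NavierStokesRegularity.NavierStokesRegularity.Theorems

end
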